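import Summits.AtomisticToContinuum.FouriersLaw.Theorems.LocalOhmBVLocalOhmHarmonicCounterexampleAux1
import Summits.AtomisticToContinuum.FouriersLaw.Theorems.LocalOhmBVLocalOhmCalibrationWindowClustering
import Summits.AtomisticToContinuum.FouriersLaw.Theorems.LocalOhmBVLocalOhmCalibrationHarmonicTelescoping
import Summits.AtomisticToContinuum.FouriersLaw.Theorems.LocalOhmBVLocalOhmCalibrationCurrentAutocovPos
import Summits.AtomisticToContinuum.FouriersLaw.Theorems.LocalOhmBVLocalOhmStubNoUnitCurrentOfZeroDrudeVarNonneg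
import Literature.MathematicalPhysics.KineticTheory.InfiniteChainTightRegular
import Literature.MathematicalPhysics.KineticTheory.InfiniteChainCurrentMoments
import Literature.MathematicalPhysics.KineticTheory.InfiniteChainGibbsExistenceShift

/-!
# The harmonic conserved-current functional: the rigidity half of the local-Ohm line is FALSE at `lam = β = 0`

Crux item stmt-AtomisticToContinuum-12009 (`Summit.AtomisticToContinuum.FouriersLaw.Theses.LocalOhmBV.LocalOhm`, shared with
`…TransferKernelPositivity.LocalOhm`), line `registered` (birth), lead c5, cycle 2 (2026-08-17). Kernel-checked CALIBRATION of the open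
rigidity stub VZD `stub_zeroDrudeVar` (variational zero current Drude weight, skeleton v10) and of its predecessor S3
`stub_oddSectorLiouvilleSym` (odd-sector Liouville rigidity, skeleton v8): both conclusions FAIL for the pinned HARMONIC chain
`pinnedChain ω₂ 0 0 γ`, so every proof of either must use the anharmonicity `lam, β > 0` ("false at lam = β = 0" of the route header).

* `tsum_integral_liouvilleZ_window_mul_bondCurrentZ_harmonic` — at the harmonic corner the static current functional
  `T_μ(f) = Σ_z ∫ f j_z dμ` of Aux 1 annihilates `𝒜(G ∘ box)` for every `C¹` polynomially bounded window profile `G`: by the telescoping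
  identity `Σ_{z=z₁}^{z₂} ∫ 𝒜(G∘box) j_z = -½(∫ G(box) u_{z₁} - ∫ G(box) u_{z₂+1})` (`harmonic_sum_integral_liouvilleZ_mul_bondCurrentZ`,
  the harmonic energy current is conserved) and clustering of the boundary covariances (`gibbs_window_cov_tendsto_zero`);
* `exists_unitCurrentFunctional_harmonic` — the witness `Λ = T_μ / c`, `c = ∫ j_0² + 2∫ j_0 j_1 > 0`
  (`gibbs_currentAutocov_three_pos`): shift invariant, odd, linear, `√n`-regular, `liouvilleZ`-invariant, unit current on every bond;
* `zeroDrudeVar_false_harmonic` — the conclusion of `stub_zeroDrudeVar` fails for `pinnedChain ω₂ 0 0 γ` and every shift-invariant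
  Gibbs state (through the landed bridge `noUnitCurrent_of_zeroDrudeVar_nonneg`, p164021);
* `oddSectorLiouvilleSym_false_harmonic` — the conclusion of `stub_oddSectorLiouvilleSym` fails for `pinnedChain ω₂ 0 0 γ`.
Folklore (the physics is Rieder–Lebowitz–Lieb 1967 / Mazur 1969: the harmonic chain has a conserved energy current); no definitions.
-/

set_option autoImplicit false

noncomputable section

namespace Summit.AtomisticToContinuum.FouriersLaw.Theorems.LocalOhmBirth

open MeasureTheory Filter Topology
open scoped BigOperators
open Literature.MathematicalPhysics.KineticTheory
open Literature.MathematicalPhysics.KineticTheory.HeatConduction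

/-! ## Harmonic invariance of the static current functional -/

/-- The window profile of the harmonic flux density `u_w = p_w² - ω₂ q_w² + (q_{w+1} - q_w)(q_w - q_{w-1})` on the box
`{w-1, w, w+1}` (anchor `-1 + w`). [folklore] -/
theorem harmonicFluxWindow_apply (ω₂ : ℝ) (w : ℤ) (σ : ChainConfig) :
    (boxRestrictAt (-1 + w) 2 σ 1).2 ^ 2 - ω₂ * (boxRestrictAt (-1 + w) 2 σ 1).1 ^ 2 +
        ((boxRestrictAt (-1 + w) 2 σ 2).1 - (boxRestrictAt (-1 + w) 2 σ 1).1) *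
          ((boxRestrictAt (-1 + w) 2 σ 1).1 - (boxRestrictAt (-1 + w) 2 σ 0).1) =
      (σ w).2 ^ 2 - ω₂ * (σ w).1 ^ 2 + ((σ (w + 1)).1 - (σ w).1) * ((σ w).1 - (σ (w - 1)).1) := by
  have e0 : (-1 + w + (((0 : Fin (2 + 1)) : ℕ) : ℤ)) = w - 1 := by simp; ring
  have e1 : (-1 + w + (((1 : Fin (2 + 1)) : ℕ) : ℤ)) = w := by simp
  have e2 : (-1 + w + (((2 : Fin (2 + 1)) : ℕ) : ℤ)) = w + 1 := by simp; ring
  simp only [boxRestrictAt_apply]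
  rw [e0, e1, e2]

/-- **At the harmonic corner the static current functional annihilates `𝒜` of every local `C¹` observable**:
`Σ'_z ∫ 𝒜(G ∘ box_{a,n}) · j_z dμ = 0` for `pinnedChain ω₂ 0 0 γ`, its shift-invariant Gibbs state `μ` at `T > 0`, and `G` a `C¹`
window profile of polynomial growth with derivative of polynomial growth. Proof: the series is the finite sum over `z ∈ [z₁, z₂]` for
all `z₁ ≤ a - 2`, `z₂ ≥ a + n + 1`; by the harmonic telescoping identity that sum is `-½(Cov(G(box), u_{z₁}) - Cov(G(box), u_{z₂+1}))`
(the means of `u_w` do not depend on `w`), and both covariances tend to `0` as `z₁ → -∞`, `z₂ → +∞` (clustering). [folklore] -/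
theorem tsum_integral_liouvilleZ_window_mul_bondCurrentZ_harmonic :
    ∀ ω₂ γ : ℝ, 0 < ω₂ → ∀ T : ℝ, 0 < T →
    ∀ μ : Measure ChainConfig, (pinnedChain ω₂ 0 0 γ).IsChainGibbsMeasure T μ → IsShiftInvariant μ →
    ∀ (a : ℤ) (n : ℕ) (G : (Fin (n + 1) → ℝ × ℝ) → ℝ), ContDiff ℝ 1 G →
      (∃ (C₀ : ℝ) (m : ℕ), ∀ y, |G y| ≤ C₀ * (1 + ‖y‖) ^ m ∧ ‖fderiv ℝ G y‖ ≤ C₀ * (1 + ‖y‖) ^ m) →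
      ∑' z : ℤ, ∫ σ, liouvilleZ (pinnedChain ω₂ 0 0 γ) (G ∘ boxRestrictAt a n) σ *
        (pinnedChain ω₂ 0 0 γ).bondCurrentZ σ z ∂μ = 0 := by
  intro ω₂ γ hω T hT μ hμ hS a n G hG hGb
  obtain ⟨C₀, m, hC₀⟩ := hGb
  set P := pinnedChain ω₂ 0 0 γ with hP
  -- `𝒜(G ∘ box_{a,n})` is a continuous polynomially bounded window function on `{a-1, …, a+n+1}`
  obtain ⟨gL, _hgLc, _hgLb, hgLeq⟩ := exists_liouvilleWindow ω₂ 0 0 γ n G hG C₀ m (fun y => (hC₀ y).2)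
  have hrep : ∀ σ, liouvilleZ P (G ∘ boxRestrictAt a n) σ = gL (boxRestrictAt (a - 1) (n + 2) σ) := fun σ => by
    have h := congrFun (hgLeq a) σ
    simpa only [Function.comp_apply] using h.symm
  set K : ℝ := ∑' z : ℤ, ∫ σ, liouvilleZ P (G ∘ boxRestrictAt a n) σ * P.bondCurrentZ σ z ∂μ with hK
  -- the flux window and the boundary covariances
  set uW : (Fin (2 + 1) → ℝ × ℝ) → ℝ := fun y =>
    (y 1).2 ^ 2 - ω₂ * (y 1).1 ^ 2 + ((y 2).1 - (y 1).1) * ((y 1).1 - (y 0).1) with huW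
  have huWc : Continuous uW := by
    simp only [huW]
    fun_prop
  have huWb : ∃ (C₁ : ℝ) (k : ℕ), ∀ y, |uW y| ≤ C₁ * (1 + ‖y‖) ^ k := by
    refine ⟨5 + |ω₂|, 2, fun y => ?_⟩
    have h0 : ‖y 0‖ ≤ ‖y‖ := norm_le_pi_norm y 0
    have h1 : ‖y 1‖ ≤ ‖y‖ := norm_le_pi_norm y 1
    have h2 : ‖y 2‖ ≤ ‖y‖ := norm_le_pi_norm y 2
    have hq0 : |(y 0).1| ≤ ‖y‖ := (norm_fst_le (y 0)).trans h0
    have hq1 : |(y 1).1| ≤ ‖y‖ := (norm_fst_le (y 1)).trans h1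
    have hq2 : |(y 2).1| ≤ ‖y‖ := (norm_fst_le (y 2)).trans h2
    have hp1 : |(y 1).2| ≤ ‖y‖ := (norm_snd_le (y 1)).trans h1
    have hy : 0 ≤ ‖y‖ := norm_nonneg y
    have hω' : 0 ≤ |ω₂| := abs_nonneg ω₂
    simp only [huW]
    calc |(y 1).2 ^ 2 - ω₂ * (y 1).1 ^ 2 + ((y 2).1 - (y 1).1) * ((y 1).1 - (y 0).1)|
        ≤ |(y 1).2| ^ 2 + |ω₂| * |(y 1).1| ^ 2 + (|(y 2).1| + |(y 1).1|) * (|(y 1).1| + |(y 0).1|) := by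
          refine (abs_add_le _ _).trans (add_le_add ((abs_sub _ _).trans (add_le_add (le_of_eq (abs_pow _ 2))
            (le_of_eq (by rw [abs_mul, abs_pow])))) ?_)
          rw [abs_mul]
          exact mul_le_mul (abs_sub _ _) (abs_sub _ _) (abs_nonneg _) (by positivity)
      _ ≤ ‖y‖ ^ 2 + |ω₂| * ‖y‖ ^ 2 + (‖y‖ + ‖y‖) * (‖y‖ + ‖y‖) := by
          gcongr
      _ ≤ (5 + |ω₂|) * (1 + ‖y‖) ^ 2 := by nlinarith [mul_nonneg hω' hy]
  set F : ℤ → ℝ := fun w => (∫ σ, G (boxRestrictAt a n σ) * uW (boxRestrictAt (-1 + w) 2 σ) ∂μ) -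
    (∫ σ, G (boxRestrictAt a n σ) ∂μ) * (∫ σ, uW (boxRestrictAt (-1 + w) 2 σ) ∂μ) with hF
  have hFlim := gibbs_window_cov_tendsto_zero ω₂ 0 0 γ hω le_rfl le_rfl T hT μ hμ hS a n G hG.continuous
    ⟨C₀, m, fun y => (hC₀ y).1⟩ (-1) 2 uW huWc huWb
  -- the means of the translated flux windows agree
  have hmean : ∀ w : ℤ, ∫ σ, uW (boxRestrictAt (-1 + w) 2 σ) ∂μ = ∫ σ, uW (boxRestrictAt (-1) 2 σ) ∂μ := by
    intro w
    have h := integral_comp_chainShift_of_isShiftInvariant hS w (fun σ => uW (boxRestrictAt (-1) 2 σ))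
    rw [← h]
    refine integral_congr_ae (Eventually.of_forall fun σ => ?_)
    have hc := congrFun (comp_boxRestrictAt_comp_chainShift (-1) w 2 uW) σ
    simpa only [Function.comp_apply] using hc.symm
  -- the telescoping identity in terms of `F`
  have hKF : ∀ k : ℕ, K = -(1 / 2) * (F (a - 2 - k) - F (a + n + 1 + k + 1)) := by
    intro k
    have hfin : K = ∑ z ∈ Finset.Icc (a - 2 - (k : ℤ)) (a + n + 1 + k),
        ∫ σ, liouvilleZ P (G ∘ boxRestrictAt a n) σ * P.bondCurrentZ σ z ∂μ := by
      rw [hK]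
      simp_rw [hrep]
      refine tsum_integral_window_mul_bondCurrentZ_eq_sum hμ (a - 1) (n + 2) gL fun z h1 h2 => ?_
      rw [Finset.mem_Icc]; push_cast at h2 ⊢; constructor <;> omega
    have hNB1 := harmonic_sum_integral_liouvilleZ_mul_bondCurrentZ ω₂ γ hω T hT μ hμ hS a n G hG ⟨C₀, m, hC₀⟩
      (a - 2 - k) (a + n + 1 + k) (by omega) (by omega)
    rw [hfin, hNB1]
    have hu : ∀ w : ℤ, ∫ σ, G (boxRestrictAt a n σ) *
        ((σ w).2 ^ 2 - ω₂ * (σ w).1 ^ 2 + ((σ (w + 1)).1 - (σ w).1) * ((σ w).1 - (σ (w - 1)).1)) ∂μ =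
        F w + (∫ σ, G (boxRestrictAt a n σ) ∂μ) * (∫ σ, uW (boxRestrictAt (-1) 2 σ) ∂μ) := by
      intro w
      rw [hF]
      simp only [← hmean w]
      have e : ∀ σ, G (boxRestrictAt a n σ) *
          ((σ w).2 ^ 2 - ω₂ * (σ w).1 ^ 2 + ((σ (w + 1)).1 - (σ w).1) * ((σ w).1 - (σ (w - 1)).1)) =
          G (boxRestrictAt a n σ) * uW (boxRestrictAt (-1 + w) 2 σ) := fun σ => by
        simp only [huW]
        rw [harmonicFluxWindow_apply ω₂ w σ]
      simp_rw [e]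
      ring
    rw [hu (a - 2 - k), hu (a + n + 1 + k + 1)]
    ring
  -- pass to the limit `k → ∞`
  have h1 : Tendsto (fun k : ℕ => F (a - 2 - k)) atTop (𝓝 0) := by
    have ht : Tendsto (fun k : ℕ => a - 2 - (k : ℤ)) atTop atBot := by
      have h := tendsto_neg_atTop_atBot.comp (tendsto_natCast_atTop_atTop (R := ℤ))
      refine (tendsto_atBot_add_const_left atTop (a - 2) h).congr fun k => ?_
      simp only [Function.comp_apply]; ring
    exact hFlim.2.comp ht
  have h2 : Tendsto (fun k : ℕ => F (a + n + 1 + k + 1)) atTop (𝓝 0) := by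
    have ht : Tendsto (fun k : ℕ => a + n + 1 + (k : ℤ) + 1) atTop atTop := by
      have h := tendsto_natCast_atTop_atTop (R := ℤ)
      refine (tendsto_atTop_add_const_right atTop 1 (tendsto_atTop_add_const_left atTop (a + n + 1) h)).congr
        fun k => ?_
      ring
    exact hFlim.1.comp ht
  have hlim : Tendsto (fun k : ℕ => -(1 / 2) * (F (a - 2 - k) - F (a + n + 1 + k + 1))) atTop (𝓝 0) := by
    have h := (h1.sub h2).const_mul (-(1 / 2) : ℝ)
    simpa using h
  have hconst : Tendsto (fun _ : ℕ => K) atTop (𝓝 K) := tendsto_const_nhds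
  have heq : (fun k : ℕ => -(1 / 2) * (F (a - 2 - k) - F (a + n + 1 + k + 1))) = fun _ => K :=
    funext fun k => (hKF k).symm
  rw [heq] at hlim
  exact tendsto_nhds_unique hconst hlim

/-! ## The witness: a shift-invariant, odd, linear, `√n`-regular, invariant functional with UNIT current -/

/-- **The harmonic conserved-current functional.** For the pinned HARMONIC chain `pinnedChain ω₂ 0 0 γ` (`ω₂ > 0`), `T > 0`, and
every shift-invariant Gibbs state `μ` of the infinite chain, the functional `Λ(f) = (Σ_z ∫ f j_z dμ) / c`,
`c = ∫ j_0² dμ + 2 ∫ j_0 j_1 dμ > 0`, is (S) shift invariant and (O) odd under momentum reversal on cylinder observables, (1) linear on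
continuous polynomially bounded cylinder pairs, (2♯) `√n`-regular, (3) `liouvilleZ`-invariant on `C¹` polynomially bounded cylinder
functions, and (4) has unit current on every bond — exactly the object that the rigidity stubs of the local-Ohm line
(`stub_oddSectorLiouvilleSym`, and `stub_zeroDrudeVar` through `noUnitCurrent_of_zeroDrudeVar_nonneg`) exclude for `lam, β > 0`.
[folklore] -/
theorem exists_unitCurrentFunctional_harmonic :
    ∀ ω₂ γ : ℝ, 0 < ω₂ → ∀ T : ℝ, 0 < T →
    ∀ μ : Measure ChainConfig, (pinnedChain ω₂ 0 0 γ).IsChainGibbsMeasure T μ → IsShiftInvariant μ →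
    ∃ Λ : (ChainConfig → ℝ) → ℝ,
      (∀ (a : ℤ) (n : ℕ) (g : (Fin (n + 1) → ℝ × ℝ) → ℝ), Continuous g →
        (∃ (C₀ : ℝ) (m : ℕ), ∀ y, |g y| ≤ C₀ * (1 + ‖y‖) ^ m) →
        Λ ((g ∘ boxRestrictAt a n) ∘ shift) = Λ (g ∘ boxRestrictAt a n)) ∧
      (∀ (a : ℤ) (n : ℕ) (g : (Fin (n + 1) → ℝ × ℝ) → ℝ), Continuous g →
        (∃ (C₀ : ℝ) (m : ℕ), ∀ y, |g y| ≤ C₀ * (1 + ‖y‖) ^ m) →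
        Λ ((g ∘ boxRestrictAt a n) ∘ momentumReversalZ) = -Λ (g ∘ boxRestrictAt a n)) ∧
      (∀ (a : ℤ) (n : ℕ) (c₁ c₂ : ℝ) (g₁ g₂ : (Fin (n + 1) → ℝ × ℝ) → ℝ), Continuous g₁ → Continuous g₂ →
        (∃ (C₀ : ℝ) (m : ℕ), ∀ y, |g₁ y| ≤ C₀ * (1 + ‖y‖) ^ m ∧ |g₂ y| ≤ C₀ * (1 + ‖y‖) ^ m) →
        Λ ((fun y => c₁ * g₁ y + c₂ * g₂ y) ∘ boxRestrictAt a n) =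
          c₁ * Λ (g₁ ∘ boxRestrictAt a n) + c₂ * Λ (g₂ ∘ boxRestrictAt a n)) ∧
      (∃ A : ℝ, ∀ (n : ℕ) (a : ℤ) (g : (Fin (n + 1) → ℝ × ℝ) → ℝ), Continuous g →
        (∃ (C₀ : ℝ) (m : ℕ), ∀ y, |g y| ≤ C₀ * (1 + ‖y‖) ^ m) →
        |Λ (g ∘ boxRestrictAt a n)| ≤
          A * Real.sqrt ((n : ℝ) + 1) * Real.sqrt (∫ σ, (g (boxRestrictAt a n σ)) ^ 2 ∂μ)) ∧
      (∀ (a : ℤ) (n : ℕ) (G : (Fin (n + 1) → ℝ × ℝ) → ℝ), ContDiff ℝ 1 G →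
        (∃ (C₀ : ℝ) (m : ℕ), ∀ y, |G y| ≤ C₀ * (1 + ‖y‖) ^ m ∧ ‖fderiv ℝ G y‖ ≤ C₀ * (1 + ‖y‖) ^ m) →
        Λ (liouvilleZ (pinnedChain ω₂ 0 0 γ) (G ∘ boxRestrictAt a n)) = 0) ∧
      (∀ i : ℤ, Λ (fun σ => (pinnedChain ω₂ 0 0 γ).bondCurrentZ σ i) = 1) := by
  intro ω₂ γ hω T hT μ hμ hS
  haveI : IsProbabilityMeasure μ := hμ.isProbabilityMeasure
  set P := pinnedChain ω₂ 0 0 γ with hP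
  -- the normalisation `c = ∫ j_0² + 2 ∫ j_0 j_1 > 0`
  set c : ℝ := (∫ σ, P.bondCurrentZ σ 0 ^ 2 ∂μ) + 2 * ∫ σ, P.bondCurrentZ σ 0 * P.bondCurrentZ σ 1 ∂μ with hc
  have hcpos : 0 < c := gibbs_currentAutocov_three_pos ω₂ 0 0 γ hω le_rfl le_rfl T hT μ hμ hS
  -- square integrability of the currents (superstability of the shift-invariant Gibbs state) and of window observables
  have hj2 : ∀ z : ℤ, MemLp (fun σ => P.bondCurrentZ σ z) 2 μ := by
    intro z
    have hss : P.HasSuperstabilityEstimate μ :=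
      (OscillatorChain.isShiftInvariant_and_hasSuperstabilityEstimate_of_tight_pinnedChain γ hω le_rfl le_rfl hT hμ
        (oneSiteTight_of_isShiftInvariant hS)).2
    obtain ⟨s₂, hs₂, hV⟩ :=
      DrudeDissolution.GramPencilHarmonicChaos.exists_isEvenPolyOfDegree_V_pinnedChain ω₂ 0 γ le_rfl
    exact hss.memLp_bondCurrentZ hs₂ (OscillatorChain.pinnedChain_U_nonneg 0 γ hω.le le_rfl)
      (OscillatorChain.measurable_pinnedChain_U ω₂ 0 0 γ) hV z ENNReal.ofNat_ne_top
  have hg2 : ∀ (a : ℤ) (n : ℕ) (g : (Fin (n + 1) → ℝ × ℝ) → ℝ), Continuous g →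
      (∃ (C₀ : ℝ) (m : ℕ), ∀ y, |g y| ≤ C₀ * (1 + ‖y‖) ^ m) → MemLp (fun σ => g (boxRestrictAt a n σ)) 2 μ :=
    fun a n g hg hb => memLp_two_comp_boxRestrictAt_of_polyBound γ hω le_rfl le_rfl hT hμ hS a n hg hb
  have hint : ∀ (a : ℤ) (n : ℕ) (g : (Fin (n + 1) → ℝ × ℝ) → ℝ), Continuous g →
      (∃ (C₀ : ℝ) (m : ℕ), ∀ y, |g y| ≤ C₀ * (1 + ‖y‖) ^ m) →
      ∀ z : ℤ, Integrable (fun σ => g (boxRestrictAt a n σ) * P.bondCurrentZ σ z) μ :=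
    fun a n g hg hb z => (hg2 a n g hg hb).integrable_mul (hj2 z)
  -- momentum-reversal invariance of `μ` (uniqueness of the shift-invariant Gibbs state)
  have hR : μ.map momentumReversalZ = μ :=
    OscillatorChain.pinnedChain_eq_of_isChainGibbsMeasure_of_isShiftInvariant γ hω le_rfl le_rfl hT
      hμ.map_momentumReversalZ hS.map_momentumReversalZ hμ hS
  -- the functional
  refine ⟨fun f => (∑' z : ℤ, ∫ σ, f σ * P.bondCurrentZ σ z ∂μ) / c, ?_, ?_, ?_, ?_, ?_, ?_⟩
  · -- (S) shift invariance
    intro a n g _ _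
    show (∑' z : ℤ, ∫ σ, ((g ∘ boxRestrictAt a n) ∘ shift) σ * P.bondCurrentZ σ z ∂μ) / c =
      (∑' z : ℤ, ∫ σ, (g ∘ boxRestrictAt a n) σ * P.bondCurrentZ σ z ∂μ) / c
    have h := tsum_integral_comp_shift_mul_bondCurrentZ P hS (g ∘ boxRestrictAt a n)
    simp only [Function.comp_apply] at h ⊢
    rw [h]
  · -- (O) oddness
    intro a n g _ _
    show (∑' z : ℤ, ∫ σ, ((g ∘ boxRestrictAt a n) ∘ momentumReversalZ) σ * P.bondCurrentZ σ z ∂μ) / c =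
      -((∑' z : ℤ, ∫ σ, (g ∘ boxRestrictAt a n) σ * P.bondCurrentZ σ z ∂μ) / c)
    have h := tsum_integral_comp_momentumReversalZ_mul_bondCurrentZ P hR (g ∘ boxRestrictAt a n)
    simp only [Function.comp_apply] at h ⊢
    rw [h, neg_div]
  · -- (1) linearity
    intro a n c₁ c₂ g₁ g₂ hg₁ hg₂ hb
    obtain ⟨C₀, m, hC₀⟩ := hb
    show (∑' z : ℤ, ∫ σ, ((fun y => c₁ * g₁ y + c₂ * g₂ y) ∘ boxRestrictAt a n) σ * P.bondCurrentZ σ z ∂μ) / c =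
      c₁ * ((∑' z : ℤ, ∫ σ, (g₁ ∘ boxRestrictAt a n) σ * P.bondCurrentZ σ z ∂μ) / c) +
        c₂ * ((∑' z : ℤ, ∫ σ, (g₂ ∘ boxRestrictAt a n) σ * P.bondCurrentZ σ z ∂μ) / c)
    simp only [Function.comp_apply]
    rw [tsum_integral_window_mul_bondCurrentZ_linear hμ a n c₁ c₂ g₁ g₂
      (hint a n g₁ hg₁ ⟨C₀, m, fun y => (hC₀ y).1⟩) (hint a n g₂ hg₂ ⟨C₀, m, fun y => (hC₀ y).2⟩)]
    ring
  · -- (2♯) `√n`-regularity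
    refine ⟨Real.sqrt (6 * ∫ σ, P.bondCurrentZ σ 0 ^ 2 ∂μ) / c, fun n a g hg hb => ?_⟩
    show |(∑' z : ℤ, ∫ σ, (g ∘ boxRestrictAt a n) σ * P.bondCurrentZ σ z ∂μ) / c| ≤ _
    simp only [Function.comp_apply]
    rw [abs_div, abs_of_pos hcpos, div_le_iff₀ hcpos]
    calc |∑' z : ℤ, ∫ σ, g (boxRestrictAt a n σ) * P.bondCurrentZ σ z ∂μ|
        ≤ Real.sqrt (6 * ∫ σ, P.bondCurrentZ σ 0 ^ 2 ∂μ) * Real.sqrt ((n : ℝ) + 1) *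
            Real.sqrt (∫ σ, (g (boxRestrictAt a n σ)) ^ 2 ∂μ) :=
          abs_tsum_integral_window_mul_bondCurrentZ_le hμ hS hj2 a n g (hg2 a n g hg hb)
      _ = Real.sqrt (6 * ∫ σ, P.bondCurrentZ σ 0 ^ 2 ∂μ) / c * Real.sqrt ((n : ℝ) + 1) *
            Real.sqrt (∫ σ, (g (boxRestrictAt a n σ)) ^ 2 ∂μ) * c := by
          field_simp
  · -- (3) invariance: the harmonic energy current is conserved
    intro a n G hG hGb
    show (∑' z : ℤ, ∫ σ, liouvilleZ P (G ∘ boxRestrictAt a n) σ * P.bondCurrentZ σ z ∂μ) / c = 0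
    rw [tsum_integral_liouvilleZ_window_mul_bondCurrentZ_harmonic ω₂ γ hω T hT μ hμ hS a n G hG hGb, zero_div]
  · -- (4) unit current on every bond
    intro i
    show (∑' z : ℤ, ∫ σ, P.bondCurrentZ σ i * P.bondCurrentZ σ z ∂μ) / c = 1
    rw [tsum_integral_bondCurrentZ_mul_bondCurrentZ_eq hμ hS i]
    exact div_self hcpos.ne'

/-! ## The two refutations at the harmonic corner -/

/-- **VZD is false at the harmonic corner.** For `pinnedChain ω₂ 0 0 γ` (`ω₂, γ > 0`), `T > 0` and every shift-invariant Gibbs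
state `μinf` of the infinite chain, the conclusion of the rigidity stub `stub_zeroDrudeVar` FAILS: the energy-current density is NOT
an `ℋ₀`-limit of `𝒜(local) + (momentum-even local)` — the harmonic conserved-current functional is linear, `√n`-regular,
`liouvilleZ`-invariant with unit current, which the landed bridge `noUnitCurrent_of_zeroDrudeVar_nonneg` excludes under VZD. Hence any
proof of `stub_zeroDrudeVar` must use `lam, β > 0`. [folklore] -/
theorem zeroDrudeVar_false_harmonic :
    ∀ ω₂ γ : ℝ, 0 < ω₂ → 0 < γ → ∀ T : ℝ, 0 < T →
    ∀ μinf : Measure ChainConfig, (pinnedChain ω₂ 0 0 γ).IsChainGibbsMeasure T μinf → IsShiftInvariant μinf →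
    ¬ (∀ ε : ℝ, 0 < ε → ∃ (a : ℤ) (n : ℕ) (G E : (Fin (n + 1) → ℝ × ℝ) → ℝ),
      ContDiff ℝ 1 G ∧
      (∃ (C₀ : ℝ) (m : ℕ), ∀ y, |G y| ≤ C₀ * (1 + ‖y‖) ^ m ∧ ‖fderiv ℝ G y‖ ≤ C₀ * (1 + ‖y‖) ^ m) ∧
      Continuous E ∧ (∃ (C₀ : ℝ) (m : ℕ), ∀ y, |E y| ≤ C₀ * (1 + ‖y‖) ^ m) ∧
      (∀ y, E (fun i => ((y i).1, -(y i).2)) = E y) ∧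
      ∀ M₀ : ℕ, ∃ M : ℕ, M₀ ≤ M ∧
        (∫ σ, (∑ x ∈ Finset.range (M + 1),
            ((pinnedChain ω₂ 0 0 γ).bondCurrentZ σ (x : ℤ) -
              liouvilleZ (pinnedChain ω₂ 0 0 γ) (G ∘ boxRestrictAt (a + (x : ℤ)) n) σ -
              E (boxRestrictAt (a + (x : ℤ)) n σ))) ^ 2 ∂μinf) ≤ ε * ((M : ℝ) + 1)) := by
  intro ω₂ γ hω hγ T hT μinf hμ hS hVZD
  obtain ⟨Λ, -, -, hlin, hbd, hinv, hcur⟩ := exists_unitCurrentFunctional_harmonic ω₂ γ hω T hT μinf hμ hS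
  exact noUnitCurrent_of_zeroDrudeVar_nonneg ω₂ 0 0 γ hω le_rfl le_rfl hγ T hT μinf hμ hS hVZD Λ hlin hbd hinv hcur

/-- **Odd-sector Liouville rigidity is false at the harmonic corner** (calibration of the c3/c4 stub `stub_oddSectorLiouvilleSym`
of skeleton v8, "false at `lam = β = 0`" of the route header, now kernel-checked): for `pinnedChain ω₂ 0 0 γ` (`ω₂ > 0`) and `T > 0`
it is NOT true that every shift-invariant, odd, linear, translation-uniformly `L²(μ∞)`-regular, `liouvilleZ`-invariant functional
over a shift-invariant Gibbs state kills the current — the harmonic conserved-current functional has `Λ(j_0) = 1`. [folklore] -/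
theorem oddSectorLiouvilleSym_false_harmonic :
    ∀ ω₂ γ : ℝ, 0 < ω₂ → ∀ T : ℝ, 0 < T →
    ¬ (∀ μinf : Measure ChainConfig, (pinnedChain ω₂ 0 0 γ).IsChainGibbsMeasure T μinf →
      IsShiftInvariant μinf →
      ∀ Λ : (ChainConfig → ℝ) → ℝ,
      (∀ (a : ℤ) (n : ℕ) (g : (Fin (n + 1) → ℝ × ℝ) → ℝ), Continuous g →
        (∃ (C₀ : ℝ) (m : ℕ), ∀ y, |g y| ≤ C₀ * (1 + ‖y‖) ^ m) →
        Λ ((g ∘ boxRestrictAt a n) ∘ shift) = Λ (g ∘ boxRestrictAt a n)) →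
      (∀ (a : ℤ) (n : ℕ) (g : (Fin (n + 1) → ℝ × ℝ) → ℝ), Continuous g →
        (∃ (C₀ : ℝ) (m : ℕ), ∀ y, |g y| ≤ C₀ * (1 + ‖y‖) ^ m) →
        Λ ((g ∘ boxRestrictAt a n) ∘ momentumReversalZ) = -Λ (g ∘ boxRestrictAt a n)) →
      (∀ (a : ℤ) (n : ℕ) (c₁ c₂ : ℝ) (g₁ g₂ : (Fin (n + 1) → ℝ × ℝ) → ℝ), Continuous g₁ → Continuous g₂ →
        (∃ (C₀ : ℝ) (m : ℕ), ∀ y, |g₁ y| ≤ C₀ * (1 + ‖y‖) ^ m ∧ |g₂ y| ≤ C₀ * (1 + ‖y‖) ^ m) →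
        Λ ((fun y => c₁ * g₁ y + c₂ * g₂ y) ∘ boxRestrictAt a n) =
          c₁ * Λ (g₁ ∘ boxRestrictAt a n) + c₂ * Λ (g₂ ∘ boxRestrictAt a n)) →
      (∀ n : ℕ, ∃ A : ℝ, ∀ (a : ℤ) (g : (Fin (n + 1) → ℝ × ℝ) → ℝ), Continuous g →
        (∃ (C₀ : ℝ) (m : ℕ), ∀ y, |g y| ≤ C₀ * (1 + ‖y‖) ^ m) →
        |Λ (g ∘ boxRestrictAt a n)| ≤ A * Real.sqrt (∫ σ, (g (boxRestrictAt a n σ)) ^ 2 ∂μinf)) →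
      (∀ (a : ℤ) (n : ℕ) (G : (Fin (n + 1) → ℝ × ℝ) → ℝ), ContDiff ℝ 1 G →
        (∃ (C₀ : ℝ) (m : ℕ), ∀ y, |G y| ≤ C₀ * (1 + ‖y‖) ^ m ∧ ‖fderiv ℝ G y‖ ≤ C₀ * (1 + ‖y‖) ^ m) →
        Λ (liouvilleZ (pinnedChain ω₂ 0 0 γ) (G ∘ boxRestrictAt a n)) = 0) →
      Λ (fun σ => (pinnedChain ω₂ 0 0 γ).bondCurrentZ σ 0) = 0) := by
  intro ω₂ γ hω T hT hrig
  obtain ⟨μ, hμ, hS, -⟩ :=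
    OscillatorChain.exists_isChainGibbsMeasure_shiftInvariant_superstable_pinnedChain γ hω le_rfl le_rfl hT
  obtain ⟨Λ, hshift, hodd, hlin, ⟨A, hA⟩, hinv, hcur⟩ := exists_unitCurrentFunctional_harmonic ω₂ γ hω T hT μ hμ hS
  have h0 := hrig μ hμ hS Λ hshift hodd hlin
    (fun n => ⟨A * Real.sqrt ((n : ℝ) + 1), fun a g hg hb => hA n a g hg hb⟩) hinv
  rw [hcur 0] at h0
  exact one_ne_zero h0

end Summit.AtomisticToContinuum.FouriersLaw.Theorems.LocalOhmBirth

end
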